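import Mathlib
import HarnessLib
import HarnessLib.Audit
import Summits.AtomisticToContinuum.Statement
import Literature.Geometry.DiscreteGeometry.KissingPatterns
import Literature.MathematicalPhysics.StatisticalMechanics.BarlowStacking
import Literature.MathematicalPhysics.StatisticalMechanics.HaggStacking
import Summits.AtomisticToContinuum.Crystallization.Theorems.ReggeStarCoercivityDefectFreeCrystallizesHullCriterion
import Summits.AtomisticToContinuum.Crystallization.Theorems.ExcessDecayLiouvilleCrysEnergyLimit
import Summits.AtomisticToContinuum.Crystallization.Theorems.PhononSlackCertificatesWindowOptimality
import Summits.AtomisticToContinuum.Crystallization.Theorems.PhononSlackCertificatesPeriodicGivenLayered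
import Summits.AtomisticToContinuum.Crystallization.Theorems.HullExactificationCascadeRobustBarlowTemplate
import HarnessLib.Audit.Status.Attr

/-!
Route: DisclinationRation

DORMANT since 2026-08-26T07:16:06Z (reconciler: no traction for 8.4 d (last activity item-evidence-added at 2026-08-17T21:17:20Z); parked, not closed — `ledger route dormant route-AtomisticToContinuum-DisclinationRation --off` to reacti) — unstaffed, not closed; items shared with open routes are served there. `ledger route dormant <id> --off` reactivates.

# Route DisclinationRation — flat space rations five-fold axes — alphabet-enlarged zero defect
density, hull exactification, Barlow–Liouville, selection

RECOMBINATION route (lens recomb, cycle 2). It suffices to show X = K1 ∧ K2 ∧ C ∧ K4 ∧ K3 ∧ S: (K1,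
energy, hull form) every sequence of
Lennard-Jones ground states in ℝ³ has a local limit (hull element: two-way matching of translates on
every ball along a subsequence)
that is uniformly separated, relatively dense and EVERYWHERE good in the enlarged alphabet — first
shell (points within 13/10 of the
nearest-neighbour distance, rescaled) 1/20-matched after a rotation to the fcc pattern, the hcp
pattern OR THE DECAHEDRAL-AXIS PATTERN
(bicapped pentagonal prism: two poles, two aligned pentagonal rings — the D₅ₕ shell of barrier
DecahedralSoftShell / negatives 4146) —
the sitewise (α)-crux of HullExactificationCascade (zero defect density + its first exactification)
with the good alphabet ENLARGED by
the positive wedge disclination; (K2, pure geometry,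
NEW) in every uniformly separated, relatively dense set all of whose points are good in this
enlarged alphabet the decahedral-axis
points have density zero uniformly on balls (flat ℝ³ cannot carry a positive density of same-sign
wedge disclinations); (C = shared
RobustBarlowTemplate 12088) everywhere fcc/hcp-good sets are Barlow-templated; (K3, given the
uniform polytype stability K4) a
templated, everywhere-good hull element of the ground states is EXACTLY a relaxed layered Barlow
stacking, read as layered windows of
the ground states at every scale (Liouville rigidity for infinite-volume minimisers, any Hägg word);
(S = shared PeriodicGivenLayered 11779) stacking selection inside the hull. With the
glue crux HullGlue (the second hull exactification) the deciding theorem `closes` assumes EXACTLY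
the seven cruxes (crux-only since
rev 4): pure logic gives periodic windows along every ground-state sequence, and both conjuncts of
Crystallization are discharged INSIDE
its proof by the PROVED tree theorems PrestressSplitKorn.stub_hullCriterion (HullCriterion 3243),
windowOptimality_proof (13962) and
crysEnergyLimit_proof (0626) with the Literature theorem LennardJonesGroundStatesExist_holds,
imported by the route file exactly as the
certified sibling routes FluxTubeKepler / GappedShellCensus do (gate deps cone: 0 unproved; lean
check rc 0, sorry-free, axioms
propext/Classical.choice/Quot.sound). The rev-1 support restatements WindowsCrystallize /
WindowsEnergy are dropped (rev 6).
Lean: `AlphabetGoodHullElement ∧ FiveFoldRation ∧ RobustBarlowTemplate ∧ UniformPolytypeStability ∧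
BarlowLiouville ∧ PeriodicGivenLayered`

## Assembly
Pure logic plus three landed theorems (glue.lean = the rendered `closes`, lean check rc 0,
sorry-free, axioms propext · Classical.choice ·
Quot.sound): for a ground-state sequence x, K1 gives an everywhere-alphabet-good, relatively dense,
δ-separated hull element S ∋ 0; K2 gives
density zero of its axis points; HullGlue gives an everywhere-{fcc,hcp}-good hull element S₂ ∋ 0; C
templates S₂ on a Barlow stacking; K3 fed
with K4 turns S₂ into layered windows of x at every scale; 11779 gives periodic windows along x
(HullMinimality.PeriodicWindows, stmt-3240's
spelling). Inside the proof, stub_hullCriterion (the proved HullCriterion 3243) turns periodic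
windows into IsCrystallizing lennardJones 3, and
windowOptimality_proof (13962: the periodic window P of a ground-state sequence — ground states
exist for every N by
LennardJonesGroundStatesExist_holds — is a least-energy periodic configuration, so ⨅ = e(P) by
IsLeast.csInf_eq) with crysEnergyLimit_proof
(0626: E(N)/N → ⨅) gives HasPeriodicGroundStateEnergy lennardJones 3; `closes` = ⟨⟨P, hleast, hlim⟩,
hpos⟩. The Assembly item is literally the
type of `closes` (seven-crux chain) and is closed by it.

Rationale: WHY THIS LINE. Every sitewise coercivity crux of this sub (ZeroDefectDensity 12086, StarCoercivity
13600, CoerciveTwoShellGap 13956, MinimiserShells 9225)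
must price the decahedral-axis shell by ENERGY, and that shell is locally almost free (five
tetrahedra close at 0.67 % strain:
Literature.Barriers.AtomisticToContinuum.DecahedralSoftShell; it refuted EffectiveLocalHales,
stmt-4146) while its true cost is the
non-local ∝ R² strain of a wedge disclination (HowieMarks1984, Doye2000) — invisible to every
finite-radius certificate; BrittleRungDescent
dodges it only by shrinking its kissing tolerance to 1/400. The recombination: put the D₅ₕ shell
INTO the good alphabet of the sitewise crux (K1, stated in the hull: some local limit is everywhere
alphabet-good), and remove it
afterwards for free by TOPOLOGY in the hull (K2: admissible five-fold columns are endless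
intersections of flat twin fans, fans of
non-parallel columns cross in non-admissible lines, and for parallel columns Gauss–Bonnet on the
cross-section bounds their number in a
disc of radius L by O(1 + L/20)/(2π − 5 arccos(1/3)), so their density is zero — the rigorous kernel
of Frank–Kasper compensation,
Nelson1983, SadocMosseri1999 §4.3, and the hull/density form of the 'rationed five-fold axes' of
card signed-frustration-alexandrov-rigidity),
then run the BANKED exactification pattern of HullExactificationCascade (support 12092 proved: a
density-zero defect
class is absent from some hull element) once more (HullGlue), the shared template C, a Liouville
rigidity for bulk-optimal GSCs templated on ANY Barlow
word (K3/K4: ExcessDecayLiouville's HcpLiouville/PhononStability taken off the hcp two-lattice, with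
the proved ForceBalance/GrainsGlue
compactness pattern and GscTwinLoopSurgery's LocalLimitStable format), and HullMinimality's staffed
selection crux 11779; the proved
HullCriterion 3243, WindowOptimality 13962 and crysEnergyLimit 0626 (invoked INSIDE the crux-only
`closes` as the landed theorems stub_hullCriterion / windowOptimality_proof / crysEnergyLimit_proof
since rev 4) finish both conjuncts. What no parent has: the energy crux never sees a
locally invisible line defect (its remaining competitors are volumetric — Frank–Kasper ≥ 1e-2, bcc
3e-2, icosahedral glass ≈ 5e-2 above
e*), no coercivity constant carries the 1e-4 stacking scale (polytype-agnostic until 11779), and no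
boundary-slack bookkeeping is needed.
Imported areas: defect topology of ordered media (wedge disclinations, Gauss–Bonnet), elliptic
regularity / Liouville rigidity, symbolic
stacking selection; no certificate/LP object (the measured 6 % two-point gap, crux 11959 evidence,
is not on this line).

RANKED CRUXES. #2 AlphabetGoodHullElement (crux) — (K1, energy in hull form; from
HullExactificationCascade.ZeroDefectDensity 12086 + its exactification HullGoodEverywhere 12089,
with the alphabet enlarged by the refutation witness of stmt-4146) for every sequence x of
Lennard-Jones ground states in ℝ³ there are δ > 0 and a hull element S ∋ 0 of x (translates x^(φ j)
+ τ_j two-way matched with S on every ball, eventually in j) which is δ-separated, relatively dense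
and EVERYWHERE alphabet-good: each y ∈ S has its shell {z ∈ S : 0 < |z − y| < 13/10·d_y} (d_y =
nearest-neighbour distance), rescaled by d_y, 1/20-matched after a linear isometry and a bijection
to fccKissingPattern, hcpKissingPattern or the 12-point decahedral-axis pattern {±e₃} ∪
{(√3/2·cos(2πk/5), √3/2·sin(2πk/5), ±1/2)}. Equivalent, by pigeonhole/compactness, to: the fraction
of non-alphabet-good particles of x^N tends to 0 (the finite-N form provers should attack).
[difficulty: open-problem] (why it might fail: A bulk phase outside the alphabet within
o(1)/particle of e*: Frank–Kasper/σ/ico-approximant (A15 is +0.086, others unmeasured), bcc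
(+0.031), ≥5 %-strained close packing; and any LOCAL proof still meets Mackay-type patches that beat
fcc up to radius ≈ 6–8.) [BlancLewin2015, FlatleyTheil2015, FrankKasper1958, Doye2000,
PartayOrtnerCsanyi2017, Radin1991, Literature.Barriers.AtomisticToContinuum.DecahedralSoftShell,
Literature.Barriers.AtomisticToContinuum.IcosahedralClusters]
#3 FiveFoldRation (crux) — (K2, NEW, pure metric geometry/topology — from the witness of negatives
4146 + barrier DecahedralSoftShell + the hull exactification pattern) for every δ > 0 and every
δ-separated, relatively dense S ⊆ ℝ³ ALL of whose points are 1/20-good in the enlarged alphabet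
{fcc, hcp, decahedral-axis}, the points that are not 1/20-{fcc,hcp}-good (the five-fold-axis points)
have density zero uniformly on balls: ∀ θ > 0 ∃ L₀ ∀ L ≥ L₀ ∀ c, #{axis points in B_L(c)} ≤ θ L³.
Mechanism: an axis point and its everywhere-good neighbourhood force five flat twin half-planes
(fans) ending only on axes; fans of non-parallel axes intersect in non-admissible lines, axes cannot
end (partial-dislocation cores are ≥ 0.2 off every pattern), so axes are parallel endless lines and
Gauss–Bonnet on a cross-sectional loop of length O(L) through ≤ 5 %-strained good material (turning
defect ≤ C·L/20) bounds the number of enclosed axes, each of deficit 2π − 5 arccos(1/3) = 0.1283 and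
of the same sign (negative wedge axes have non-admissible shells), by O(L): density O(1/L²)·L/L³ →
0. [difficulty: L] (why it might fail: Twin surfaces through 1/20-good sites might bend or stop at
sub-tolerance disconnections, letting finite or skew axes coexist at positive density; or an exotic
non-Barlow arrangement makes decahedral-pattern shells that are not wedge disclinations
(Böröczky–Szabó-type flexibility at 5 %).) [HowieMarks1984, Nelson1983, SadocMosseri1999,
Coxeter1958, LucaFriesecke2016, HalesDSP2012, BoroczkySzabo2016, doi:10.1088/0022-3719/5/5/004,
Literature.Barriers.AtomisticToContinuum.DecahedralSoftShell]
#4 RobustBarlowTemplate (crux) — (C, SHARED verbatim with HullExactificationCascade stmt-12088; pure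
geometry) every nonempty δ-separated S ⊆ ℝ³ all of whose points are 1/20-{fcc,hcp}-good is the
bijective image of an ideal Barlow stacking barlowStacking 1 √(2/3) s (IsHaggSeq s) under a map
1/20-close to a similarity on every unit cluster. [difficulty: L] (why it might fail: Tolerance 1/20
may be too generous for unambiguous propagation of the layering direction across fcc-type regions
(slow rotation drift at bounded strain); Böröczky–Szabó / KKLS-type flexible twelve-neighbour
constructions are the threat models.) [HalesDSP2012, Hales2012, BoroczkySzabo2016,
KusnerKusnerLagariasShlosman2018, FrieseckeJamesMuller2002]
#5 UniformPolytypeStability (crux) — (K4, certified numerics; ExcessDecayLiouville.PhononStability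
9333 taken off the hcp two-lattice) there is ONE κ > 0 such that for every in-layer spacing a ∈
[47/50, 1], every Hägg word s and every interlayer-height sequence z with increments in [39a/50,
17a/20] for which the layered set L(a,s,z) (triangular layers, hole registry haggLabel s, heights z)
is in exact Lennard-Jones force balance, the LJ Hessian quadratic form on finitely supported
displacements u of L(a,s,z) dominates κ·Σ_{|p−q|≤11/10}|u_p − u_q|² (acoustic + optical stability
uniform in the word — finite stacking windows + tail bounds make it a finite interval computation).
[difficulty: L] (why it might fail: Equilibrium leaves a free (in-plane prestress up to ±3 % on the
box): a soft shear branch of some polytype at a = 1 (tension) or a = 47/50, or near-degenerate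
optical modes of long-period words, would push κ to 0; float Bloch scans exist for fcc/hcp only.)
[AyalaChoksiWirth2025, HudsonOrtner2014, EhrlacherOrtnerShapeev2016, Stillinger2001,
SchwerdtfegerBurrowsSmits2021, EMing2006]
#6 BarlowLiouville (crux) — (K3, Liouville rigidity for infinite-volume minimisers, ANY word;
ExcessDecayLiouville.HcpLiouville 9332 recombined with the template format of 12088 and the hull
format of GscTwinLoopSurgery.LocalLimitStable 14086 / HullExactificationCascade 12092) given K4: for
every sequence x of LJ ground states, every δ-separated, relatively dense hull element X of x that
is everywhere 1/20-{fcc,hcp}-good and Barlow-templated (conclusion of C) IS a rigid motion of an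
exact relaxed layered set L(a,s,z) (a ∈ [47/50,1], IsHaggSeq s, increments in [39a/50, 17a/20]) —
stated through its use: x has layered windows at every scale in the format of LayeredWindows 11778
(the hypothesis of 11779). Intended proof: hull elements are canonical GSCs (LocalLimitStable) and
bulk-optimal (HullBulkOptimal, proved) ⇒ force balance and zero mean stress (affine test
modifications); template + everywhere-good ⇒ piecewise-affine interpolation O(1/20)-near the
conformal group, so Reshetnyak/FJM conformal rigidity (d = 3) kills rotation/scale drift up to a
bounded-energy strain field; bulk optimality + K4 (convexity over the layered family — the
polytype-agnostic near field of PhononSlackCertificates moved to infinite volume) ⇒ strain has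
density zero at every tolerance ⇒ re-limit / Caccioppoli + discrete unique continuation (landed
HcpLiouville files) ⇒ exactly layered; windows of X are windows of x frequently in N. [deps:
UniformPolytypeStability, RobustBarlowTemplate] [difficulty: XL] (why it might fail: Nonlinear
discrete elliptic systems in 3-D lack Liouville without smallness: a bulk-optimal GSC that is a
bounded 1/20-modulation of a layered stacking (static breather, incommensurate shuffle at zero
energy-density cost) refutes it; conformal-rigidity constants at ε ≈ C/20 may be too weak.)
[EhrlacherOrtnerShapeev2016, HudsonOrtner2014, FrieseckeJamesMuller2002, EMing2006, Suto2011,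
Radin1991, doi:10.1007/978-94-015-8360-2]
#7 PeriodicGivenLayered (crux) — (S, SHARED verbatim with HullMinimality / PhononSlackCertificates /
FluxTubeKepler stmt-11779; staffed, majorisation + one-crossing lemmas proved) layered windows at
every scale along a sequence of LJ ground states (triangular layers in hole registry, free Hägg
word, free spacings in the box) imply periodic windows at every scale (one periodic P). [difficulty:
L] (why it might fail: Fails if Hägg domination |J₂| > Σ(k−1)|J_k| breaks on the relaxed (a,
spacing) box (ratio 287–587, uncertified numerics; an exceptional coupling gives Sturmian words =
Hubbard risk), or if faults are syndetic in every layered limit.) [LoachAckland2017,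
PartayOrtnerCsanyi2017, Stillinger2001, Radin1991,
Literature.Barriers.AtomisticToContinuum.ShortRangeStackingBlindness]
#9 HullGlue (crux) — (glue, support-grade, kept a crux because the deciding theorem may assume crux
items only) exactification no. 2 in the pattern of the PROVED HullExactShells 12092, for the
{fcc,hcp}-good predicate: for a sequence x of LJ ground states and a hull element S ∋ 0 of x that is
δ-separated, relatively dense and everywhere alphabet-good, if the non-{fcc,hcp}-good points of S
have density zero uniformly on balls (the conclusion of K2) then some hull element S₂ ∋ 0 of x is
δ-separated, relatively dense and EVERYWHERE 1/20-{fcc,hcp}-good (grid/pigeonhole gives axis-free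
balls B_{L_k}(y_k) ⊆ S, recentre, local limit of S − y_k is a hull element — limits of limits — and
goodness passes to limits). [difficulty: L] (why it might fail: Soft compactness only (proved
verbatim for the hcp-shell predicate as hullExactShells_proof); a mis-typed cutoff (open 13/10·d vs
closed matching) or limit order that does not pass to local limits is the realistic failure.)
[Radin1991, BlancLewin2015, Suto2011, BellissardRadinShlosman2010, HalesDSP2012]

TWO-LAYER PLAN. Foreseen glued splits (nothing filed now): FiveFoldRation ⇐ FanStructure (an
alphabet-good neighbourhood of an axis point carries five
flat twin half-planes; axes are endless, pairwise parallel) → CrossSectionGaussBonnet (≤ C(1 +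
L/20)/0.1283 parallel axes through a disc of
radius L) → FiveFoldRation. BarlowLiouville ⇐ ZeroStressAffine (GSC ⇒ force balance + zero mean
stress; template ⇒ global near-similarity
by conformal rigidity) → LayeredCoercivityInfinite (K4 + bulk optimality ⇒ strain density zero at
every tolerance) → BarlowLiouville.
AlphabetGoodHullElement ⇐ ZeroAlphabetDefectDensity (finite-N fraction → 0) → exactification no. 1
(pattern of 12089) → AlphabetGoodHullElement; then any (α)-engine on file restated with the enlarged
alphabet (Regge-star LP, priced link census with five-ring
charge 0, flux-cell Kepler) — an ALTERNATIVE decomposition would be a separate route sharing the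
decl.

KILL CRITERIA. ¬FiveFoldRation by an explicit everywhere-{fcc,hcp,D₅ₕ}-good configuration with a
positive density of axis points closes the route outright
(refuted:FiveFoldRation) and is itself a barrier-grade fact (Frank–Kasper without compensators).
¬AlphabetGoodHullElement (a competing
bulk phase within o(1) of e* in every local limit) refutes every sitewise route of the sub at once.
¬BarlowLiouville by a bounded modulated bulk-optimal GSC ⇒
pivot K3 to the coercivity form (split above) at a smaller tolerance fed by a second exactification.
¬UniformPolytypeStability (a soft
polytype on the box) ⇒ shrink the box to the zero-stress neighbourhood (restate). PeriodicWindows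
3240 proved elsewhere moots the route;
11779 refuted (aperiodic optimal stacking) kills conjunct (ii) for every layered route including
this one.

NOT DECOMPOSED YET. The fan-structure lemma and the cross-section Gauss–Bonnet count inside K2
(layer-2 children); the zero-stress and conformal-rigidity steps
inside K3; the finite-N form and the relative-density step inside K1 (no isolated particles); the
certified interval computation behind K4 (Bloch blocks over
stacking windows of length ≤ 4 plus an r⁻⁸ Hessian tail); any choice of (α)-engine for K1.

CHEAPEST FALSIFIER. For K2: build by hand/kit a doubly periodic array of PARALLEL five-fold columns
joined by twin planes running axis-to-axis (rows on y = 0,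
±D, …, rays at ±70.53° landing on the next row's axes) and check whether every site can be 1/20-good
without a negative-wedge (inadmissible)
axis — Gauss–Bonnet says no (total deficit density 0.1283·ρ_axes > 0 uncompensated); a closed
example refutes K2. Checked in-session: the
closed decahedral-axis shell of the barrier (axis edge 1 + 0.0067, ten edges 1 − 0.0067) is within
0.014 of the typed pattern after
rescaling by d (≪ 1/20), the icosahedral shell is ≥ 0.5 away (staggered rings) and the negative
(4,1)/(6,0) wedge-axis shells have a √2 ring
gap / 14 points, hence are NOT in the alphabet. For K1: the LJ energies of σ, C14/C15, Z and
Bergman/Mackay approximants per particle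
(A15 +0.086, simple hexagonal +0.153, bcc +0.031 from crux 11958 evidence LP-RESULTS R6); any value
within 1e-3 of e(hcp) = −0.7176 kills
the healthier-margin claim.

NUMBERS. e(hcp a* = 0.9712) = −0.717604, e(fcc) = −0.717487, bcc −0.686, A15 −0.631, sh −0.565
(Blanc–Lewin units; crux 11958 LP-RESULTS); decahedral
closure strain η⋆ ≈ 0.0067 and the D₅ₕ shell "two poles + two aligned pentagonal rings"
(Literature.Barriers.AtomisticToContinuum.DecahedralSoftShell,
proved); wedge deficit 2π − 5 arccos(1/3) = 0.12834 rad; typed decahedral pattern: 12 unit vectors,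
25 pairs at distance < 1.05, ring–ring
1.018; deviation of the closed strained shell from it after rescaling 0.0135 < 0.05; tolerances 1/20
(pattern), 13/10 (shell cutoff), box
a ∈ [47/50, 1], increments ∈ [39a/50, 17a/20] (inherited from 12086/12088/11778 so that the shared
items attach verbatim). Items: 7 at open; rev 1–3: 7 cruxes + 2 supports + Assembly; rev 4–6:
crux-only `closes`, Assembly = its type (seven-crux chain), the 2 support restatements dropped — 8
items.

DEFINITION REQUESTS. None. The decahedral-axis pattern is inlined (12 explicit points via !₂[·],
Real.cos/sin); fccKissingPattern, hcpKissingPattern, barlowStacking,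
IsHaggSeq, haggLabel, triangularVec₁/₂, barlowOffset, layerNormal, interactionEnergy, IsGroundState,
PeriodicConfiguration exist (elaborated in
Sketch.lean). A later `Literature.Geometry.DiscreteGeometry.decahedralKissingPattern` (integer
model) would shorten K1/K2.

Novelty: Searches (2026-08-16): `lit search --source s2 "crystallization conjecture" --year-from 2023` (25
rows; relevant: arXiv:2602.05294 lattice
hard-core criteria; arXiv:2604.19239 Kreutz–Ziereis polycrystal Γ-limit — read pp. 1–4, 35–36:
assumes local crystallinity, cites
stratification results, nothing on disclination density); `lit search --hybrid "disclination density
Frank-Kasper phases flat space curvature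
compensation rigorous"` (10 books: Kleman–Lavrentovich 2003, Kleinert 2008, Sadoc–Mosseri via tree
key — heuristic balance laws only);
`lit galaxy search "density of disclinations" --star all` (22 rows,
liquid-crystal/continuum-mechanics, none on point configurations);
`lit galaxy search "five-fold twinning disclination density" --star all` (0); arXiv/zbMATH/OpenAlex
legs rate-limited (HTTP 429) this session;
in-tree: Ideas grep — cards signed-frustration-alexandrov-rigidity (K3 'finite-ball axis budget',
(C) 'few axes', unrouted) and
twin-holonomy-far-field (energetic R² pricing, unrouted), garland-hodge-balance (averaged spectral
law); routes: none of the 35 open routes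
enlarges the good alphabet or rations axes (lever table in planner NOTES).
Nearest prior art found: card
AtomisticToContinuum/Crystallization/signed-frustration-alexandrov-rigidity (Alexandrov-curvature ≥
0 of the ideal
octet metric ⇒ at most O(η) axis ends / O(ηL) five-ring length per ball; its own assembly goes
through 'periodic ⇒ Barlow' and a cell-shape
coercivity with a negative five-ring allowance);  [refs: 2602.05294, 2604.19239, HowieMarks1984, Doye2000, SadocMosseri1999, Nelson1983, HalesDSP2012]

Barriers (technique_class: hull-exactification, disclination-rationing, liouville): - technique_class: hull-exactification, disclination-rationing, liouville
- Literature.Barriers.AtomisticToContinuum.DecahedralSoftShell: used as a RESOURCE — its D₅ₕ shell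
is put into the good alphabet of K1 and removed by K2's topology, so no energy inequality of this
route has to see it (the barrier kills local shell classification at 1 %; K1 classifies nothing
locally and K2 is global).
- Literature.Barriers.AtomisticToContinuum.TetrahedralFrustration: K2 IS the barrier's angle 2π − 5
arccos(1/3) turned into a Gauss–Bonnet count; K1 still has to beat polytetrahedral BULK phases
(conceded: that is the open-problem part, margin ≈ 1e-2 instead of 1e-3).
- Literature.Barriers.AtomisticToContinuum.IcosahedralClusters: icosahedral shells are deliberately
NOT in the alphabet (staggered rings, ≥ 0.5 from the decahedral pattern): Mackay/FK order must be
priced by K1 volumetrically; finite clusters are irrelevant in the hull.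
- Literature.Barriers.AtomisticToContinuum.KissingTwelveDegeneracy and .FlexibleKissingArrangements:
respected — the alphabet is pattern-level at tolerance 1/20 with the 13/10 cutoff (jitterbug-twisted
shells beyond ≈ 3° are bad and priced as strain); no contact-graph inference is made (the move that
died in 4146).
- Literature.Barriers.AtomisticToContinuum.ShortRangeStackingBlindness: respected — fcc- and
hcp-type shells are both good; stacking is selected only in 11779 by the full tail.
- Literature.Barriers.AtomisticToContinuum.AperiodicTilingGroundStates a

History (route lifecycle, newest last):
- 2026-08-16T17:03:19Z · rev 3: restated Assembly (stmt-AtomisticToContinuum-15803) — cone repair step 3/3: legacy Assembly (7-hypothesis chain, glue.unused-crux advisory; drop is refused for assembly items) restated to the 9-hypothesis chain of (planner-rrepair-AtomisticToContinuum-Disclinat-8a986b99-0)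
- 2026-08-16T17:19:22Z · rev 5: restated Assembly (stmt-AtomisticToContinuum-16005) — glue repair follow-up: Assembly restated from the 9-hypothesis chain (which named the two support restatements WindowsCrystallize/WindowsEnergy) to the 7-crux c (planner-rbadge-AtomisticToContinuum-Disclinati-8a986b99-0)
- 2026-08-16T17:20:11Z · rev 6: dropped WindowsCrystallize, WindowsEnergy — glue repair cleanup: drop the two rev-1 SUPPORT restatements WindowsCrystallize (= proved HullCriterion 3243) and WindowsEnergy (= proved WindowOptimality 13962 (planner-rbadge-AtomisticToContinuum-Disclinati-8a986b99-0)
- 2026-08-26T07:16:06Z · DORMANT — reconciler: no traction for 8.4 d (last activity item-evidence-added at 2026-08-17T21:17:20Z); parked, not closed — `ledger route dormant route-AtomisticToConti (operator:999:3640422)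

sub-problem: Crystallization · status: dormant · opened planner-plan-lens-AtomisticToContinuum-recomb-v2-g2-0 2026-08-16T16:44:32Z · rev 6 · ledger route-AtomisticToContinuum-DisclinationRation
GENERATED by the gate from the ledger (D-0016/17). Provers cite these decls: `theorem foo : Summit.AtomisticToContinuum.Crystallization.Theses.DisclinationRation.<Decl> := …` in Summits/AtomisticToContinuum/Crystallization/Theorems/<Name>.lean.
-/

namespace Summit.AtomisticToContinuum.Crystallization.Theses.DisclinationRation

open scoped BigOperators Topology Manifold Classical MeasureTheory ProbabilityTheory Matrix InnerProductSpace ComplexConjugate ContinuousMap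
open Filter Set Function TopologicalSpace MeasureTheory

attribute [summit_statement] _root_.Crystallization

/-- item stmt-AtomisticToContinuum-15798 · crux · rank 2 · open · by planner
why it might fail: A bulk phase outside the alphabet within o(1)/particle of e*: Frank–Kasper/σ/ico-approximant (A15 is +0.086, others unmeasured), bcc (+0.031), ≥5 %-strained close packing; and any LOCAL proof still meets Mackay-type patches that beat fcc up to radius ≈ 6–8.
sources: BlancLewin2015, FlatleyTheil2015, FrankKasper1958, Doye2000, PartayOrtnerCsanyi2017, Radin1991
[crux] (K1, energy in hull form; from HullExactificationCascade.ZeroDefectDensity 12086 + its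
exactification HullGoodEverywhere 12089, with the alphabet enlarged by the refutation witness of
stmt-4146) for every sequence x of Lennard-Jones ground states in ℝ³ there are δ > 0 and a hull
element S ∋ 0 of x (translates x^(φ j) + τ_j two-way matched with S on every ball, eventually in j)
which is δ-separated, relatively dense and EVERYWHERE alphabet-good: each y ∈ S has its shell {z ∈ S
: 0 < |z − y| < 13/10·d_y} (d_y = nearest-neighbour distance), rescaled by d_y, 1/20-matched after a
linear isometry and a bijection to fccKissingPattern, hcpKissingPattern or the 12-point
decahedral-axis pattern {±e₃} ∪ {(√3/2·cos(2πk/5), √3/2·sin(2πk/5), ±1/2)}. Equivalent, by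
pigeonhole/compactness, to: the fraction of non-alphabet-good particles of x^N tends to 0 (the
finite-N form provers should attack). [difficulty: open-problem] -/
@[route_item "route-AtomisticToContinuum-DisclinationRation", crux]
def AlphabetGoodHullElement : Prop :=
  let GA : Set (EuclideanSpace ℝ (Fin 3)) → EuclideanSpace ℝ (Fin 3) → Prop := fun S y => let d : ℝ := sInf ((fun z => dist z y) '' (S \ {y})); let T : Set (EuclideanSpace ℝ (Fin 3)) := {z : EuclideanSpace ℝ (Fin 3) | z ∈ S ∧ z ≠ y ∧ dist z y < 13 / 10 * d}; ∃ A : EuclideanSpace ℝ (Fin 3) →ₗᵢ[ℝ] EuclideanSpace ℝ (Fin 3), (∃ e : ↥T ≃ ↥Literature.Geometry.DiscreteGeometry.fccKissingPattern, ∀ t : ↥T, dist (d⁻¹ • ((t : EuclideanSpace ℝ (Fin 3)) - y)) (A ((e t : ↥Literature.Geometry.DiscreteGeometry.fccKissingPattern) : EuclideanSpace ℝ (Fin 3))) ≤ 1 / 20) ∨ (∃ e : ↥T ≃ ↥Literature.Geometry.DiscreteGeometry.hcpKissingPattern, ∀ t : ↥T, dist (d⁻¹ • ((t : EuclideanSpace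 ℝ (Fin 3)) - y)) (A ((e t : ↥Literature.Geometry.DiscreteGeometry.hcpKissingPattern) : EuclideanSpace ℝ (Fin 3))) ≤ 1 / 20) ∨ (∃ e : ↥T ≃ ↥{p : EuclideanSpace ℝ (Fin 3) | p = !₂[(0 : ℝ), 0, 1] ∨ p = !₂[(0 : ℝ), 0, -1] ∨ ∃ k : Fin 5, ∃ σ : ℝ, (σ = 1 / 2 ∨ σ = -(1 / 2)) ∧ p = !₂[Real.sqrt 3 / 2 * Real.cos (2 * Real.pi * (k : ℝ) / 5), Real.sqrt 3 / 2 * Real.sin (2 * Real.pi * (k : ℝ) / 5), σ]}, ∀ t : ↥T, dist (d⁻¹ • ((t : EuclideanSpace ℝ (Fin 3)) - y)) (A ((e t : ↥{p : EuclideanSpace ℝ (Fin 3) | p = !₂[(0 : ℝ), 0, 1] ∨ p = !₂[(0 : ℝ), 0, -1] ∨ ∃ k : Fin 5, ∃ σ : ℝ, (σ = 1 / 2 ∨ σ = -(1 / 2)) ∧ p = !₂[Real.sqrt 3 / 2 * Real.cos (2 * Real.pi * (k : ℝ) / 5), Real.sqrt 3 / 2 * Real.sin (2 * Real.pi * (k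 : ℝ) / 5), σ]}) : EuclideanSpace ℝ (Fin 3))) ≤ 1 / 20); let HL : ((N : ℕ) → (Fin N → EuclideanSpace ℝ (Fin 3))) → Set (EuclideanSpace ℝ (Fin 3)) → Prop := fun x S => ∃ φ : ℕ → ℕ, StrictMono φ ∧ ∃ τ : ℕ → EuclideanSpace ℝ (Fin 3), ∀ R ε : ℝ, 0 < ε → ∀ᶠ j : ℕ in Filter.atTop, (∀ s ∈ S, ‖s‖ ≤ R → ∃ i : Fin (φ j), dist (x (φ j) i + τ j) s ≤ ε) ∧ (∀ i : Fin (φ j), ‖x (φ j) i + τ j‖ ≤ R → ∃ s ∈ S, dist (x (φ j) i + τ j) s ≤ ε); ∀ (x : (N : ℕ) → (Fin N → EuclideanSpace ℝ (Fin 3))), (∀ N, Literature.MathematicalPhysics.StatisticalMechanics.IsGroundState Literature.MathematicalPhysics.StatisticalMechanics.lennardJones (x N)) → ∃ S : Set (EuclideanSpace ℝ (Fin 3)), ∃ δ : ℝ, 0 < δ ∧ (∀ y ∈ S, ∀ z ∈ S, y ≠ z → δ ≤ dist y z) ∧ (0 : EuclideanSpace ℝ (Fin 3)) ∈ S ∧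 HL x S ∧ (∀ y ∈ S, GA S y) ∧ (∃ R₁ : ℝ, ∀ p : EuclideanSpace ℝ (Fin 3), ∃ y ∈ S, dist y p ≤ R₁)

/-- item stmt-AtomisticToContinuum-15799 · crux · rank 3 · open · by planner
why it might fail: Twin surfaces through 1/20-good sites might bend or stop at sub-tolerance disconnections, letting finite or skew axes coexist at positive density; or an exotic non-Barlow arrangement makes decahedral-pattern shells that are not wedge disclinations (Böröczky–Szabó-type flexibility at 5 %).
sources: HowieMarks1984, Nelson1983, SadocMosseri1999, Coxeter1958, LucaFriesecke2016, HalesDSP2012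
[crux] (K2, NEW, pure metric geometry/topology — from the witness of negatives 4146 + barrier
DecahedralSoftShell + the hull exactification pattern) for every δ > 0 and every δ-separated,
relatively dense S ⊆ ℝ³ ALL of whose points are 1/20-good in the enlarged alphabet {fcc, hcp,
decahedral-axis}, the points that are not 1/20-{fcc,hcp}-good (the five-fold-axis points) have
density zero uniformly on balls: ∀ θ > 0 ∃ L₀ ∀ L ≥ L₀ ∀ c, #{axis points in B_L(c)} ≤ θ L³.
Mechanism: an axis point and its everywhere-good neighbourhood force five flat twin half-planes
(fans) ending only on axes; fans of non-parallel axes intersect in non-admissible lines, axes cannot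
end (partial-dislocation cores are ≥ 0.2 off every pattern), so axes are parallel endless lines and
Gauss–Bonnet on a cross-sectional loop of length O(L) through ≤ 5 %-strained good material (turning
defect ≤ C·L/20) bounds the number of enclosed axes, each of deficit 2π − 5 arccos(1/3) = 0.1283 and
of the same sign (negative wedge axes have non-admissible shells), by O(L): density O(1/L²)·L/L³ →
0. [difficulty: L] -/
@[route_item "route-AtomisticToContinuum-DisclinationRation", crux]
def FiveFoldRation : Prop :=
  let GA : Set (EuclideanSpace ℝ (Fin 3)) → EuclideanSpace ℝ (Fin 3) → Prop := fun S y => let d : ℝ := sInf ((fun z => dist z y) '' (S \ {y})); let T : Set (EuclideanSpace ℝ (Fin 3)) := {z : EuclideanSpace ℝ (Fin 3) | z ∈ S ∧ z ≠ y ∧ dist z y < 13 / 10 * d}; ∃ A : EuclideanSpace ℝ (Fin 3) →ₗᵢ[ℝ] EuclideanSpace ℝ (Fin 3), (∃ e : ↥T ≃ ↥Literature.Geometry.DiscreteGeometry.fccKissingPattern, ∀ t : ↥T, dist (d⁻¹ • ((t : EuclideanSpace ℝ (Fin 3)) - y)) (A ((e t : ↥Literature.Geometry.DiscreteGeometry.fccKissingPattern)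 : EuclideanSpace ℝ (Fin 3))) ≤ 1 / 20) ∨ (∃ e : ↥T ≃ ↥Literature.Geometry.DiscreteGeometry.hcpKissingPattern, ∀ t : ↥T, dist (d⁻¹ • ((t : EuclideanSpace ℝ (Fin 3)) - y)) (A ((e t : ↥Literature.Geometry.DiscreteGeometry.hcpKissingPattern) : EuclideanSpace ℝ (Fin 3))) ≤ 1 / 20) ∨ (∃ e : ↥T ≃ ↥{p : EuclideanSpace ℝ (Fin 3) | p = !₂[(0 : ℝ), 0, 1] ∨ p = !₂[(0 : ℝ), 0, -1] ∨ ∃ k : Fin 5, ∃ σ : ℝ, (σ = 1 / 2 ∨ σ = -(1 / 2)) ∧ p = !₂[Real.sqrt 3 / 2 * Real.cos (2 * Real.pi * (k : ℝ) / 5), Real.sqrt 3 / 2 * Real.sin (2 * Real.pi * (k : ℝ) / 5), σ]}, ∀ t : ↥T, dist (d⁻¹ • ((t : EuclideanSpace ℝ (Fin 3)) - y)) (A ((e t : ↥{p : EuclideanSpace ℝ (Fin 3) | p = !₂[(0 : ℝ), 0, 1] ∨ p = !₂[(0 : ℝ), 0, -1] ∨ ∃ k : Fin 5, ∃ σ :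 ℝ, (σ = 1 / 2 ∨ σ = -(1 / 2)) ∧ p = !₂[Real.sqrt 3 / 2 * Real.cos (2 * Real.pi * (k : ℝ) / 5), Real.sqrt 3 / 2 * Real.sin (2 * Real.pi * (k : ℝ) / 5), σ]}) : EuclideanSpace ℝ (Fin 3))) ≤ 1 / 20); let GF : Set (EuclideanSpace ℝ (Fin 3)) → EuclideanSpace ℝ (Fin 3) → Prop := fun S y => let d : ℝ := sInf ((fun z => dist z y) '' (S \ {y})); let T : Set (EuclideanSpace ℝ (Fin 3)) := {z : EuclideanSpace ℝ (Fin 3) | z ∈ S ∧ z ≠ y ∧ dist z y < 13 / 10 * d}; ∃ A : EuclideanSpace ℝ (Fin 3) →ₗᵢ[ℝ] EuclideanSpace ℝ (Fin 3), (∃ e : ↥T ≃ ↥Literature.Geometry.DiscreteGeometry.fccKissingPattern, ∀ t : ↥T, dist (d⁻¹ • ((t : EuclideanSpace ℝ (Fin 3)) - y)) (A ((e t : ↥Literature.Geometry.DiscreteGeometry.fccKissingPattern) : EuclideanSpace ℝ (Fin 3))) ≤ 1 / 20) ∨ (∃ e : ↥T ≃ ↥Literature.Geometry.DiscreteGeometry.hcpKissingPattern,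 ∀ t : ↥T, dist (d⁻¹ • ((t : EuclideanSpace ℝ (Fin 3)) - y)) (A ((e t : ↥Literature.Geometry.DiscreteGeometry.hcpKissingPattern) : EuclideanSpace ℝ (Fin 3))) ≤ 1 / 20); ∀ δ : ℝ, 0 < δ → ∀ S : Set (EuclideanSpace ℝ (Fin 3)), (∀ y ∈ S, ∀ z ∈ S, y ≠ z → δ ≤ dist y z) → (∃ R₁ : ℝ, ∀ p : EuclideanSpace ℝ (Fin 3), ∃ y ∈ S, dist y p ≤ R₁) → (∀ y ∈ S, GA S y) → (∀ θ : ℝ, 0 < θ → ∃ L₀ : ℝ, ∀ L : ℝ, L₀ ≤ L → ∀ c : EuclideanSpace ℝ (Fin 3), (({y : EuclideanSpace ℝ (Fin 3) | y ∈ S ∧ dist y c ≤ L ∧ ¬ GF S y} : Set (EuclideanSpace ℝ (Fin 3))).ncard : ℝ) ≤ θ * L ^ 3)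

/-- item stmt-AtomisticToContinuum-12088 · crux · rank 4 · closed · proved by Summit.AtomisticToContinuum.Crystallization.Theorems.robustBarlowTemplate_proof @ 463c6c30d593 (prover) · by planner
why it might fail: Tolerance 1/20 may be too generous for unambiguous propagation of the layering direction across fcc-type regions (slow rotation drift at bounded strain); Böröczky–Szabó / KKLS-type flexible twelve-neighbour constructions are the threat models.
sources: HalesDSP2012, Hales2012, BoroczkySzabo2016, KusnerKusnerLagariasShlosman2018, FrieseckeJamesMuller2002
[crux] (C) pure metric geometry, no potential: for every δ > 0, every nonempty δ-separated S ⊆ ℝ³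
all of whose points are 1/20-good is Φ(barlowStacking 1 √(2/3) s) for some Hägg sequence s and a
bijection Φ that is 1/20-close to a similarity x ↦ Φp + l_p·A_p(x − p) on every cluster {q : |q − p|
≤ 1} — the robust form of the PROVED HalesDSP_layerPackings_holds with the pattern identification
supplied as INPUT at every point (no Fejes Tóth / Hales Theorem 1 needed); two non-parallel fault
systems cannot coexist in an everywhere-good infinite configuration (they would meet), foreign
points cannot approach a template (covering radius of the (anti)cuboctahedron 45° < 60°).
[difficulty: L] -/
@[route_item "route-AtomisticToContinuum-DisclinationRation", crux]
def RobustBarlowTemplate : Prop :=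
  ∀ δ : ℝ, 0 < δ → ∀ S : Set (EuclideanSpace ℝ (Fin 3)), S.Nonempty → (∀ y ∈ S, ∀ z ∈ S, y ≠ z → δ ≤ dist y z) → (∀ y ∈ S, (let d : ℝ := sInf ((fun z => dist z y) '' (S \ {y})); let T : Set (EuclideanSpace ℝ (Fin 3)) := {z : EuclideanSpace ℝ (Fin 3) | z ∈ S ∧ z ≠ y ∧ dist z y < 13 / 10 * d}; ∃ A : EuclideanSpace ℝ (Fin 3) →ₗᵢ[ℝ] EuclideanSpace ℝ (Fin 3), (∃ e : ↥T ≃ ↥Literature.Geometry.DiscreteGeometry.fccKissingPattern, ∀ t : ↥T, dist (d⁻¹ • ((t : EuclideanSpace ℝ (Fin 3)) - y)) (A ((e t : ↥Literature.Geometry.DiscreteGeometry.fccKissingPattern) : EuclideanSpace ℝ (Fin 3))) ≤ 1 / 20) ∨ (∃ e : ↥T ≃ ↥Literature.Geometry.DiscreteGeometry.hcpKissingPattern, ∀ t : ↥T, dist (d⁻¹ • ((t : EuclideanSpace ℝ (Fin 3)) - y)) (A ((e t : ↥Literature.Geometry.DiscreteGeometry.hcpKissingPattern) : EuclideanSpace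 ℝ (Fin 3))) ≤ 1 / 20))) → (∃ s : ℤ → ℤ, Literature.MathematicalPhysics.StatisticalMechanics.IsHaggSeq s ∧ ∃ Φ : EuclideanSpace ℝ (Fin 3) → EuclideanSpace ℝ (Fin 3), Set.BijOn Φ (Literature.MathematicalPhysics.StatisticalMechanics.barlowStacking 1 (Real.sqrt (2 / 3)) s) S ∧ ∀ p ∈ Literature.MathematicalPhysics.StatisticalMechanics.barlowStacking 1 (Real.sqrt (2 / 3)) s, ∃ A : EuclideanSpace ℝ (Fin 3) →ₗᵢ[ℝ] EuclideanSpace ℝ (Fin 3), ∃ l : ℝ, 0 < l ∧ ∀ q ∈ Literature.MathematicalPhysics.StatisticalMechanics.barlowStacking 1 (Real.sqrt (2 / 3)) s, dist q p ≤ 1 → dist (Φ q) (Φ p + l • A (q - p)) ≤ 1 / 20 * l)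

/-- `RobustBarlowTemplate` holds: proved by `Summit.AtomisticToContinuum.Crystallization.Theorems.robustBarlowTemplate_proof` @ 463c6c30d593. -/
theorem RobustBarlowTemplate_holds : RobustBarlowTemplate := _root_.Summit.AtomisticToContinuum.Crystallization.Theorems.robustBarlowTemplate_proof

/-- item stmt-AtomisticToContinuum-15800 · crux · rank 5 · open · by planner
why it might fail: Equilibrium leaves a free (in-plane prestress up to ±3 % on the box): a soft shear branch of some polytype at a = 1 (tension) or a = 47/50, or near-degenerate optical modes of long-period words, would push κ to 0; float Bloch scans exist for fcc/hcp only.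
sources: AyalaChoksiWirth2025, HudsonOrtner2014, EhrlacherOrtnerShapeev2016, Stillinger2001, SchwerdtfegerBurrowsSmits2021, EMing2006
[crux] (K4, certified numerics; ExcessDecayLiouville.PhononStability 9333 taken off the hcp
two-lattice) there is ONE κ > 0 such that for every in-layer spacing a ∈ [47/50, 1], every Hägg word
s and every interlayer-height sequence z with increments in [39a/50, 17a/20] for which the layered
set L(a,s,z) (triangular layers, hole registry haggLabel s, heights z) is in exact Lennard-Jones
force balance, the LJ Hessian quadratic form on finitely supported displacements u of L(a,s,z)
dominates κ·Σ_{|p−q|≤11/10}|u_p − u_q|² (acoustic + optical stability uniform in the word — finite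
stacking windows + tail bounds make it a finite interval computation). [difficulty: L] -/
@[route_item "route-AtomisticToContinuum-DisclinationRation", crux]
def UniformPolytypeStability : Prop :=
  ∃ κ : ℝ, 0 < κ ∧ ∀ (a : ℝ) (s : ℤ → ℤ) (z : ℤ → ℝ), 47 / 50 ≤ a → a ≤ 1 → Literature.MathematicalPhysics.StatisticalMechanics.IsHaggSeq s → (∀ m : ℤ, 39 / 50 * a ≤ z (m + 1) - z m ∧ z (m + 1) - z m ≤ 17 / 20 * a) → let Hess : EuclideanSpace ℝ (Fin 3) → EuclideanSpace ℝ (Fin 3) → ℝ := fun e w => deriv (deriv Literature.MathematicalPhysics.StatisticalMechanics.lennardJones) ‖e‖ * (inner ℝ e w / ‖e‖) ^ 2 + deriv Literature.MathematicalPhysics.StatisticalMechanics.lennardJones ‖e‖ / ‖e‖ * (‖w‖ ^ 2 - (inner ℝ e w / ‖e‖) ^ 2); let Sites : Set (EuclideanSpace ℝ (Fin 3)) := {p | ∃ m i j : ℤ, p = ((i : ℝ) • Literature.MathematicalPhysics.StatisticalMechanics.triangularVec₁ a) + ((j : ℝ) • Literature.MathematicalPhysics.StatisticalMechanics.triangularVec₂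 a) + ((Literature.MathematicalPhysics.StatisticalMechanics.haggLabel s m : ℝ) • Literature.MathematicalPhysics.StatisticalMechanics.barlowOffset a) + (z m • Literature.MathematicalPhysics.StatisticalMechanics.layerNormal 1)}; (∀ p ∈ Sites, HasSum (fun q : {q : EuclideanSpace ℝ (Fin 3) // q ∈ Sites ∧ q ≠ p} => (deriv Literature.MathematicalPhysics.StatisticalMechanics.lennardJones (dist p q.1) / dist p q.1) • (p - q.1)) 0) → ∀ u : EuclideanSpace ℝ (Fin 3) → EuclideanSpace ℝ (Fin 3), (Function.support u).Finite → Function.support u ⊆ Sites → κ * (∑' p : Sites, ∑' q : Sites, if dist (p : EuclideanSpace ℝ (Fin 3)) q ≤ 11 / 10 then ‖u p - u q‖ ^ 2 else 0) ≤ (∑' p : Sites, ∑' q : Sites, if (p : EuclideanSpace ℝ (Fin 3)) ≠ q then Hess ((p : EuclideanSpace ℝ (Fin 3)) - q) (u p - u q) else 0) / 2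

/-- item stmt-AtomisticToContinuum-15801 · crux · rank 6 · open · by planner
why it might fail: Nonlinear discrete elliptic systems in 3-D lack Liouville without smallness: a bulk-optimal GSC that is a bounded 1/20-modulation of a layered stacking (static breather, incommensurate shuffle at zero energy-density cost) refutes it; conformal-rigidity constants at ε ≈ C/20 may be too weak.
sources: EhrlacherOrtnerShapeev2016, HudsonOrtner2014, FrieseckeJamesMuller2002, EMing2006, Suto2011, Radin1991
[crux] (K3, Liouville rigidity for infinite-volume minimisers, ANY word;
ExcessDecayLiouville.HcpLiouville 9332 recombined with the template format of 12088 and the hull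
format of GscTwinLoopSurgery.LocalLimitStable 14086 / HullExactificationCascade 12092) given K4: for
every sequence x of LJ ground states, every δ-separated, relatively dense hull element X of x that
is everywhere 1/20-{fcc,hcp}-good and Barlow-templated (conclusion of C) IS a rigid motion of an
exact relaxed layered set L(a,s,z) (a ∈ [47/50,1], IsHaggSeq s, increments in [39a/50, 17a/20]) —
stated through its use: x has layered windows at every scale in the format of LayeredWindows 11778
(the hypothesis of 11779). Intended proof: hull elements are canonical GSCs (LocalLimitStable) and
bulk-optimal (HullBulkOptimal, proved) ⇒ force balance and zero mean stress (affine test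
modifications); template + everywhere-good ⇒ piecewise-affine interpolation O(1/20)-near the
conformal group, so Reshetnyak/FJM conformal rigidity (d = 3) kills rotation/scale drift up to a
bounded-energy strain field; bulk optimality + K4 (convexity over the layered family — the
polytype-agnostic near field of PhononSlackCertificates moved to in -/
@[route_item "route-AtomisticToContinuum-DisclinationRation", crux]
def BarlowLiouville : Prop :=
  UniformPolytypeStability → let GF : Set (EuclideanSpace ℝ (Fin 3)) → EuclideanSpace ℝ (Fin 3) → Prop := fun S y => let d : ℝ := sInf ((fun z => dist z y) '' (S \ {y})); let T : Set (EuclideanSpace ℝ (Fin 3)) := {z : EuclideanSpace ℝ (Fin 3) | z ∈ S ∧ z ≠ y ∧ dist z y < 13 / 10 * d}; ∃ A : EuclideanSpace ℝ (Fin 3) →ₗᵢ[ℝ] EuclideanSpace ℝ (Fin 3), (∃ e : ↥T ≃ ↥Literature.Geometry.DiscreteGeometry.fccKissingPattern, ∀ t : ↥T, dist (d⁻¹ • ((t : EuclideanSpace ℝ (Fin 3)) - y)) (A ((e t : ↥Literature.Geometry.DiscreteGeometry.fccKissingPattern) : EuclideanSpace ℝ (Fin 3))) ≤ 1 / 20)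 ∨ (∃ e : ↥T ≃ ↥Literature.Geometry.DiscreteGeometry.hcpKissingPattern, ∀ t : ↥T, dist (d⁻¹ • ((t : EuclideanSpace ℝ (Fin 3)) - y)) (A ((e t : ↥Literature.Geometry.DiscreteGeometry.hcpKissingPattern) : EuclideanSpace ℝ (Fin 3))) ≤ 1 / 20); let HL : ((N : ℕ) → (Fin N → EuclideanSpace ℝ (Fin 3))) → Set (EuclideanSpace ℝ (Fin 3)) → Prop := fun x S => ∃ φ : ℕ → ℕ, StrictMono φ ∧ ∃ τ : ℕ → EuclideanSpace ℝ (Fin 3), ∀ R ε : ℝ, 0 < ε → ∀ᶠ j : ℕ in Filter.atTop, (∀ s ∈ S, ‖s‖ ≤ R → ∃ i : Fin (φ j), dist (x (φ j) i + τ j) s ≤ ε) ∧ (∀ i : Fin (φ j), ‖x (φ j) i + τ j‖ ≤ R → ∃ s ∈ S, dist (x (φ j) i + τ j) s ≤ ε); ∀ (x : (N : ℕ) → (Fin N → EuclideanSpace ℝ (Fin 3))), (∀ N, Literature.MathematicalPhysics.StatisticalMechanics.IsGroundState Literature.MathematicalPhysics.StatisticalMechanics.lennardJones (x N)) → ∀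 δ : ℝ, 0 < δ → ∀ X : Set (EuclideanSpace ℝ (Fin 3)), (∀ y ∈ X, ∀ z ∈ X, y ≠ z → δ ≤ dist y z) → HL x X → (∃ R₁ : ℝ, ∀ p : EuclideanSpace ℝ (Fin 3), ∃ y ∈ X, dist y p ≤ R₁) → (∀ y ∈ X, GF X y) → (∃ s : ℤ → ℤ, Literature.MathematicalPhysics.StatisticalMechanics.IsHaggSeq s ∧ ∃ Φ : EuclideanSpace ℝ (Fin 3) → EuclideanSpace ℝ (Fin 3), Set.BijOn Φ (Literature.MathematicalPhysics.StatisticalMechanics.barlowStacking 1 (Real.sqrt (2 / 3)) s) X ∧ ∀ p ∈ Literature.MathematicalPhysics.StatisticalMechanics.barlowStacking 1 (Real.sqrt (2 / 3)) s, ∃ A : EuclideanSpace ℝ (Fin 3) →ₗᵢ[ℝ] EuclideanSpace ℝ (Fin 3), ∃ l : ℝ, 0 < l ∧ ∀ q ∈ Literature.MathematicalPhysics.StatisticalMechanics.barlowStacking 1 (Real.sqrt (2 / 3)) s, dist q p ≤ 1 → dist (Φ q) (Φ p + l • A (q - p)) ≤ 1 / 20 * l) → (∃ a : ℝ, 47 /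 50 ≤ a ∧ a ≤ 1 ∧ ∀ R ε : ℝ, 0 < ε → ∃ᶠ N in Filter.atTop, ∃ (A : EuclideanSpace ℝ (Fin 3) →ₗᵢ[ℝ] EuclideanSpace ℝ (Fin 3)) (t : EuclideanSpace ℝ (Fin 3)) (s : ℤ → ℤ) (z : ℤ → ℝ), Literature.MathematicalPhysics.StatisticalMechanics.IsHaggSeq s ∧ (∀ m : ℤ, 39 / 50 * a ≤ z (m + 1) - z m ∧ z (m + 1) - z m ≤ 17 / 20 * a) ∧ let S : Set (EuclideanSpace ℝ (Fin 3)) := {p | ∃ m i j : ℤ, p = A (((i : ℝ) • Literature.MathematicalPhysics.StatisticalMechanics.triangularVec₁ a) + ((j : ℝ) • Literature.MathematicalPhysics.StatisticalMechanics.triangularVec₂ a) + ((Literature.MathematicalPhysics.StatisticalMechanics.haggLabel s m : ℝ) • Literature.MathematicalPhysics.StatisticalMechanics.barlowOffset a) + (z m • Literature.MathematicalPhysics.StatisticalMechanics.layerNormal 1))}; (∀ p ∈ S, ‖p‖ ≤ R → ∃ i : Fin N, dist (x N i + t) p ≤ ε) ∧ (∀ i : Fin N, ‖x N i + t‖ ≤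 R → ∃ p ∈ S, dist (x N i + t) p ≤ ε))

/-- item stmt-AtomisticToContinuum-11779 · crux · rank 7 · closed · proved by Summit.AtomisticToContinuum.Crystallization.Theorems.LayeredHull.PeriodicGivenLayered_of @ 3a4fd92cd160 (prover) · by planner
why it might fail: Fails if Hägg domination |J₂| > Σ(k−1)|J_k| breaks on the relaxed (a, spacing) box (ratio 287–587, uncertified numerics; an exceptional coupling gives Sturmian words = Hubbard risk), or if faults are syndetic in every layered limit.
sources: LoachAckland2017, PartayOrtnerCsanyi2017, Stillinger2001, Radin1991, Literature.Barriers.AtomisticToContinuum.ShortRangeStackingBlindness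
[crux] PERIODIC GIVEN LAYERED (card items H2/H3 "zero fault density suffices"; stacking selection
INSIDE THE HULL): for every sequence of LJ ground states, layered windows at every scale in the
sense of LayeredWindows (same a, A, t, s, z data) imply periodic windows at every scale in the sense
of PeriodicWindows (one periodic P; expected relaxed hcp = a rotated barlowPeriodicConfiguration of
the alternating word, but ANY periodic polytype is allowed). Intended mechanism: Hägg domination on
the box (LjRegistryDomination stmt-3063 feeding the Peierls count HaggDominationAllRanges stmt-0737)
prices every non-alternating letter pair at ≥ c > 0 per unit area; dislocation-loop surgery at
radius ρ ≫ C/c shows the fault density of an energy-minimising layered limit is zero; fault-free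
slabs of every thickness relax exponentially to constant spacing; compactness of O(3) × [47/50,1]
fixes one P. Only a SYNDETIC fault pattern in every layered limit defeats it. [deps: LayeredWindows]
[difficulty: L] -/
@[route_item "route-AtomisticToContinuum-DisclinationRation", crux]
def PeriodicGivenLayered : Prop :=
  ∀ x : (N : ℕ) → (Fin N → EuclideanSpace ℝ (Fin 3)), (∀ N, Literature.MathematicalPhysics.StatisticalMechanics.IsGroundState Literature.MathematicalPhysics.StatisticalMechanics.lennardJones (x N)) → (∃ a : ℝ, 47 / 50 ≤ a ∧ a ≤ 1 ∧ ∀ R ε : ℝ, 0 < ε → ∃ᶠ N in Filter.atTop, ∃ (A : EuclideanSpace ℝ (Fin 3) →ₗᵢ[ℝ] EuclideanSpace ℝ (Fin 3)) (t : EuclideanSpace ℝ (Fin 3)) (s : ℤ → ℤ) (z : ℤ → ℝ), Literature.MathematicalPhysics.StatisticalMechanics.IsHaggSeq s ∧ (∀ m : ℤ, 39 / 50 * a ≤ z (m + 1) - z m ∧ z (m + 1) - z m ≤ 17 / 20 * a) ∧ let S : Set (EuclideanSpace ℝ (Fin 3)) := {p | ∃ m i j : ℤ, p = A (((i : ℝ)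 • Literature.MathematicalPhysics.StatisticalMechanics.triangularVec₁ a) + ((j : ℝ) • Literature.MathematicalPhysics.StatisticalMechanics.triangularVec₂ a) + ((Literature.MathematicalPhysics.StatisticalMechanics.haggLabel s m : ℝ) • Literature.MathematicalPhysics.StatisticalMechanics.barlowOffset a) + (z m • Literature.MathematicalPhysics.StatisticalMechanics.layerNormal 1))}; (∀ p ∈ S, ‖p‖ ≤ R → ∃ i : Fin N, dist (x N i + t) p ≤ ε) ∧ (∀ i : Fin N, ‖x N i + t‖ ≤ R → ∃ p ∈ S, dist (x N i + t) p ≤ ε)) → ∃ P : Literature.MathematicalPhysics.StatisticalMechanics.PeriodicConfiguration 3, ∀ R ε : ℝ, 0 < ε → ∃ᶠ N in Filter.atTop, ∃ t : EuclideanSpace ℝ (Fin 3), (∀ s ∈ P.points, ‖s‖ ≤ R → ∃ i : Fin N, dist (x N i + t) s ≤ ε) ∧ (∀ i : Fin N, ‖x N i + t‖ ≤ R → ∃ s ∈ P.points, dist (x N i + t) s ≤ ε)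

/-- `PeriodicGivenLayered` holds: proved by `Summit.AtomisticToContinuum.Crystallization.Theorems.LayeredHull.PeriodicGivenLayered_of` @ 3a4fd92cd160. -/
theorem PeriodicGivenLayered_holds : PeriodicGivenLayered := _root_.Summit.AtomisticToContinuum.Crystallization.Theorems.LayeredHull.PeriodicGivenLayered_of

/-- item stmt-AtomisticToContinuum-15802 · crux · rank 9 · closed · proved by Summit.AtomisticToContinuum.Crystallization.Theorems.DisclinationRationHullGlue.HullGlue_of @ 31f3d4f22f14 (prover) · by planner
why it might fail: Soft compactness only (proved verbatim for the hcp-shell predicate as hullExactShells_proof); a mis-typed cutoff (open 13/10·d vs closed matching) or limit order that does not pass to local limits is the realistic failure.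
sources: Radin1991, BlancLewin2015, Suto2011, BellissardRadinShlosman2010, HalesDSP2012
[crux] (glue, support-grade, kept a crux because the deciding theorem may assume crux items only)
exactification no. 2 in the pattern of the PROVED HullExactShells 12092, for the {fcc,hcp}-good
predicate: for a sequence x of LJ ground states and a hull element S ∋ 0 of x that is δ-separated,
relatively dense and everywhere alphabet-good, if the non-{fcc,hcp}-good points of S have density
zero uniformly on balls (the conclusion of K2) then some hull element S₂ ∋ 0 of x is δ-separated,
relatively dense and EVERYWHERE 1/20-{fcc,hcp}-good (grid/pigeonhole gives axis-free balls
B_{L_k}(y_k) ⊆ S, recentre, local limit of S − y_k is a hull element — limits of limits — and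
goodness passes to limits). [difficulty: L] -/
@[route_item "route-AtomisticToContinuum-DisclinationRation", crux]
def HullGlue : Prop :=
  let GA : Set (EuclideanSpace ℝ (Fin 3)) → EuclideanSpace ℝ (Fin 3) → Prop := fun S y => let d : ℝ := sInf ((fun z => dist z y) '' (S \ {y})); let T : Set (EuclideanSpace ℝ (Fin 3)) := {z : EuclideanSpace ℝ (Fin 3) | z ∈ S ∧ z ≠ y ∧ dist z y < 13 / 10 * d}; ∃ A : EuclideanSpace ℝ (Fin 3) →ₗᵢ[ℝ] EuclideanSpace ℝ (Fin 3), (∃ e : ↥T ≃ ↥Literature.Geometry.DiscreteGeometry.fccKissingPattern, ∀ t : ↥T, dist (d⁻¹ • ((t : EuclideanSpace ℝ (Fin 3)) - y)) (A ((e t : ↥Literature.Geometry.DiscreteGeometry.fccKissingPattern) : EuclideanSpace ℝ (Fin 3))) ≤ 1 / 20) ∨ (∃ e : ↥T ≃ ↥Literature.Geometry.DiscreteGeometry.hcpKissingPattern, ∀ t : ↥T, dist (d⁻¹ • ((t : EuclideanSpace ℝ (Fin 3)) - y)) (A ((e t : ↥Literature.Geometry.DiscreteGeometry.hcpKissingPattern)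 : EuclideanSpace ℝ (Fin 3))) ≤ 1 / 20) ∨ (∃ e : ↥T ≃ ↥{p : EuclideanSpace ℝ (Fin 3) | p = !₂[(0 : ℝ), 0, 1] ∨ p = !₂[(0 : ℝ), 0, -1] ∨ ∃ k : Fin 5, ∃ σ : ℝ, (σ = 1 / 2 ∨ σ = -(1 / 2)) ∧ p = !₂[Real.sqrt 3 / 2 * Real.cos (2 * Real.pi * (k : ℝ) / 5), Real.sqrt 3 / 2 * Real.sin (2 * Real.pi * (k : ℝ) / 5), σ]}, ∀ t : ↥T, dist (d⁻¹ • ((t : EuclideanSpace ℝ (Fin 3)) - y)) (A ((e t : ↥{p : EuclideanSpace ℝ (Fin 3) | p = !₂[(0 : ℝ), 0, 1] ∨ p = !₂[(0 : ℝ), 0, -1] ∨ ∃ k : Fin 5, ∃ σ : ℝ, (σ = 1 / 2 ∨ σ = -(1 / 2)) ∧ p = !₂[Real.sqrt 3 / 2 * Real.cos (2 * Real.pi * (k : ℝ) / 5), Real.sqrt 3 / 2 * Real.sin (2 * Real.pi * (k : ℝ) / 5), σ]}) : EuclideanSpace ℝ (Fin 3))) ≤ 1 / 20); let GF : Set (EuclideanSpace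 ℝ (Fin 3)) → EuclideanSpace ℝ (Fin 3) → Prop := fun S y => let d : ℝ := sInf ((fun z => dist z y) '' (S \ {y})); let T : Set (EuclideanSpace ℝ (Fin 3)) := {z : EuclideanSpace ℝ (Fin 3) | z ∈ S ∧ z ≠ y ∧ dist z y < 13 / 10 * d}; ∃ A : EuclideanSpace ℝ (Fin 3) →ₗᵢ[ℝ] EuclideanSpace ℝ (Fin 3), (∃ e : ↥T ≃ ↥Literature.Geometry.DiscreteGeometry.fccKissingPattern, ∀ t : ↥T, dist (d⁻¹ • ((t : EuclideanSpace ℝ (Fin 3)) - y)) (A ((e t : ↥Literature.Geometry.DiscreteGeometry.fccKissingPattern) : EuclideanSpace ℝ (Fin 3))) ≤ 1 / 20) ∨ (∃ e : ↥T ≃ ↥Literature.Geometry.DiscreteGeometry.hcpKissingPattern, ∀ t : ↥T, dist (d⁻¹ • ((t : EuclideanSpace ℝ (Fin 3)) - y)) (A ((e t : ↥Literature.Geometry.DiscreteGeometry.hcpKissingPattern) : EuclideanSpace ℝ (Fin 3))) ≤ 1 / 20); let HL : ((N : ℕ) → (Fin N → EuclideanSpace ℝ (Fin 3))) → Set (EuclideanSpace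 ℝ (Fin 3)) → Prop := fun x S => ∃ φ : ℕ → ℕ, StrictMono φ ∧ ∃ τ : ℕ → EuclideanSpace ℝ (Fin 3), ∀ R ε : ℝ, 0 < ε → ∀ᶠ j : ℕ in Filter.atTop, (∀ s ∈ S, ‖s‖ ≤ R → ∃ i : Fin (φ j), dist (x (φ j) i + τ j) s ≤ ε) ∧ (∀ i : Fin (φ j), ‖x (φ j) i + τ j‖ ≤ R → ∃ s ∈ S, dist (x (φ j) i + τ j) s ≤ ε); (∀ (x : (N : ℕ) → (Fin N → EuclideanSpace ℝ (Fin 3))), (∀ N, Literature.MathematicalPhysics.StatisticalMechanics.IsGroundState Literature.MathematicalPhysics.StatisticalMechanics.lennardJones (x N)) → ∀ (S : Set (EuclideanSpace ℝ (Fin 3))) (δ : ℝ), 0 < δ → (∀ y ∈ S, ∀ z ∈ S, y ≠ z → δ ≤ dist y z) → HL x S → (∃ R₁ : ℝ, ∀ p : EuclideanSpace ℝ (Fin 3), ∃ y ∈ S, dist y p ≤ R₁) → (∀ y ∈ S, GA S y) → (∀ θ : ℝ, 0 < θ → ∃ L₀ : ℝ, ∀ L : ℝ, L₀ ≤ L →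 ∀ c : EuclideanSpace ℝ (Fin 3), (({y : EuclideanSpace ℝ (Fin 3) | y ∈ S ∧ dist y c ≤ L ∧ ¬ GF S y} : Set (EuclideanSpace ℝ (Fin 3))).ncard : ℝ) ≤ θ * L ^ 3) → ∃ S₂ : Set (EuclideanSpace ℝ (Fin 3)), (∀ y ∈ S₂, ∀ z ∈ S₂, y ≠ z → δ ≤ dist y z) ∧ (0 : EuclideanSpace ℝ (Fin 3)) ∈ S₂ ∧ HL x S₂ ∧ (∃ R₁ : ℝ, ∀ p : EuclideanSpace ℝ (Fin 3), ∃ y ∈ S₂, dist y p ≤ R₁) ∧ (∀ y ∈ S₂, GF S₂ y))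

-- `HullGlue` holds: proved by `Summit.AtomisticToContinuum.Crystallization.Theorems.DisclinationRationHullGlue.HullGlue_of` @ 31f3d4f22f14 (its module imports this route file, so no `_holds` link can be stated here).

-- earlier Assembly (stmt-AtomisticToContinuum-15803, replaced 2026-08-16T17:03:19Z -> stmt-AtomisticToContinuum-16005): retired by None — AlphabetGoodHullElement → FiveFoldRation → RobustBarlowTemplate → UniformPolytypeStability → BarlowLiouville → PeriodicGivenLayered → HullGlue → _root_.Crystallization
-- earlier Assembly (stmt-AtomisticToContinuum-16005, replaced 2026-08-16T17:19:22Z -> stmt-AtomisticToContinuum-16169): retired by None — AlphabetGoodHullElement → FiveFoldRation → RobustBarlowTemplate → UniformPolytypeStability → BarlowLiouville → PeriodicGivenLayered → HullGlue → WindowsCrystallize → WindowsEnergy → _root_.Crystallization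
/-- item stmt-AtomisticToContinuum-16169 · assembly · rank 1 · open · by planner
sources: BlancLewin2015, Radin1991
[assembly] AlphabetGoodHullElement → FiveFoldRation → RobustBarlowTemplate →
UniformPolytypeStability → BarlowLiouville → PeriodicGivenLayered → HullGlue → Crystallization —
literally the type of the crux-only deciding theorem `closes` (rev 4: the seven cruxes are its only
hypotheses; the proved HullCriterion 3243, WindowOptimality 13962 and crysEnergyLimit 0626 are
invoked inside its proof); a prover closes this item with `closes` itself (one line, importing only
this route file). -/
@[route_item "route-AtomisticToContinuum-DisclinationRation"]
def Assembly : Prop :=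
  AlphabetGoodHullElement → FiveFoldRation → RobustBarlowTemplate → UniformPolytypeStability → BarlowLiouville → PeriodicGivenLayered → HullGlue → _root_.Crystallization

/-! D-0027 §2.1 — DECIDING THEOREM (planner-authored via `route open/edit --closes-file`; by planner-rbadge-AtomisticToContinuum-Disclinati-8a986b99-0 2026-08-16T17:18:38Z):
its hypotheses are this route's items and its conclusion the sub-problem Statement (glue_lint), and it elaborates with this file. -/

/-- Deciding theorem (D-0027 §2.1, crux-only form — human ruling 2026-08-16): the seven cruxes give, by pure
logic, periodic windows along every sequence of Lennard-Jones ground states (in the spelling of the shared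
statement `HullMinimality.PeriodicWindows`, stmt-3240); the two conjuncts of `Crystallization` are then
DISCHARGED INSIDE THE PROOF by tree theorems that are already proved — conjunct (ii) by the hull criterion
`PrestressSplitKorn.stub_hullCriterion` (item stmt-3243), conjunct (i) by `windowOptimality_proof`
(stmt-13962: the periodic window of a ground-state sequence is a least-energy periodic configuration),
`crysEnergyLimit_proof` (stmt-0626: `E(N)/N → ⨅_Q e(Q)`) and the Literature theorem
`LennardJonesGroundStatesExist_holds` — no support item is a hypothesis any more. -/
@[closes "route-AtomisticToContinuum-DisclinationRation"] theorem closes (h1 : AlphabetGoodHullElement) (h2 : FiveFoldRation) (h3 : RobustBarlowTemplate)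
    (h4 : UniformPolytypeStability) (h5 : BarlowLiouville) (h6 : PeriodicGivenLayered) (h7 : HullGlue) :
    _root_.Crystallization := by
  -- (1) pure logic over the cruxes: periodic windows along every sequence of LJ ground states
  have hPW : _root_.Summit.AtomisticToContinuum.Crystallization.Theses.HullMinimality.PeriodicWindows := by
    intro x hx
    obtain ⟨S, δ, hδ, hsep, h0, hhull, hgood, hdense⟩ := h1 x hx
    have hrat := h2 δ hδ S hsep hdense hgood
    obtain ⟨S₂, hsep₂, h0₂, hhull₂, hdense₂, hgood₂⟩ := h7 x hx S δ hδ hsep hhull hdense hgood hrat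
    have htemp := h3 δ hδ S₂ ⟨0, h0₂⟩ hsep₂ hgood₂
    exact h6 x hx (h5 h4 x hx δ hδ S₂ hsep₂ hhull₂ hdense₂ hgood₂ htemp)
  -- (2) conjunct (ii): the hull criterion (stmt-3243, PROVED in the tree)
  have hpos : Literature.MathematicalPhysics.StatisticalMechanics.IsCrystallizing
      Literature.MathematicalPhysics.StatisticalMechanics.lennardJones 3 :=
    _root_.Summit.AtomisticToContinuum.Crystallization.Theorems.PrestressSplitKorn.stub_hullCriterion hPW
  -- (3) conjunct (i): ground states exist (Literature theorem); their periodic window `P` is a least-energy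
  --     periodic configuration (stmt-13962, PROVED), so `⨅_Q e(Q) = e(P)` and `E(N)/N → e(P)` (stmt-0626, PROVED)
  have hex : Literature.MathematicalPhysics.StatisticalMechanics.LennardJonesGroundStatesExist :=
    Literature.MathematicalPhysics.StatisticalMechanics.LennardJonesGroundStatesExist_holds
  obtain ⟨x, hx⟩ : ∃ x : (N : ℕ) → (Fin N → EuclideanSpace ℝ (Fin 3)), ∀ N,
      Literature.MathematicalPhysics.StatisticalMechanics.IsGroundState
        Literature.MathematicalPhysics.StatisticalMechanics.lennardJones (x N) :=
    ⟨fun N => (hex N).choose, fun N => (hex N).choose_spec⟩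
  obtain ⟨P, hP⟩ := hPW x hx
  have hleast : IsLeast (Set.range fun Q : Literature.MathematicalPhysics.StatisticalMechanics.PeriodicConfiguration 3 =>
      Q.energyPerParticle Literature.MathematicalPhysics.StatisticalMechanics.lennardJones)
      (P.energyPerParticle Literature.MathematicalPhysics.StatisticalMechanics.lennardJones) :=
    _root_.Summit.AtomisticToContinuum.Crystallization.Theorems.windowOptimality_proof x hx P hP
  have hinf : (⨅ Q : Literature.MathematicalPhysics.StatisticalMechanics.PeriodicConfiguration 3,
      Q.energyPerParticle Literature.MathematicalPhysics.StatisticalMechanics.lennardJones) =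
      P.energyPerParticle Literature.MathematicalPhysics.StatisticalMechanics.lennardJones := hleast.csInf_eq
  have hlim : Filter.Tendsto (fun N : ℕ => Literature.MathematicalPhysics.StatisticalMechanics.groundStateEnergy
      Literature.MathematicalPhysics.StatisticalMechanics.lennardJones 3 N / N) Filter.atTop
      (nhds (P.energyPerParticle Literature.MathematicalPhysics.StatisticalMechanics.lennardJones)) := by
    have hEL := _root_.Summit.AtomisticToContinuum.Crystallization.Theorems.crysEnergyLimit_proof
    unfold Summit.AtomisticToContinuum.Crystallization.Theses.ExcessDecayLiouville.CrysEnergyLimit at hEL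
    rw [hinf] at hEL
    exact hEL
  exact ⟨⟨P, hleast, hlim⟩, hpos⟩

end Summit.AtomisticToContinuum.Crystallization.Theses.DisclinationRation
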